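import Summits.BirchSwinnertonDyer.BirchSwinnertonDyer.Theorems.ThetaPartnerAtTwoSignedControlAtTwoSignedEulerCharCount
import HarnessLib

/-!
# The ONE-SIDED signed control value at `2` from the `±` local input alone: `g(0) ∣ #Sel_{2^∞}(E/ℚ) · 2^{ord₂ ∏ c_ℓ}` in `ℤ₂`
# (B. D. Kim 2013 Cor. 3.15, the `≤` half, READ AT `2` for Kobayashi's `Sel⁺` — no Cassels–Poitou–Tate, no Thm. 1.1)

Route `ThetaPartnerAtTwo` (TP2), crux K4 `SignedControlAtTwo` (stmt-BirchSwinnertonDyer-20309), line `eulerchar` v4. K4's conjunct (ii)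
is the two-sided value `g(0) = u · 2^{ord₂ ∏ c_ℓ} · #Sel_{2^∞}(E/ℚ)`; v4 derives it from INJ⁺@2 + PUB Cassels + KIM⁺@2. THIS FILE records
what the `±` local input INJ⁺@2 («`r₂⁺` injective») gives BY ITSELF, for any consumer that needs only one inequality (an Eisenstein /
lower-half argument): for every Pontryagin-dual datum `D` of `Sel⁺(E/ℚ_∞)` and generator `g` of `char X⁺`, `Sel_{2^∞}(E/ℚ)` finite ⇒
`X⁺` is finitely generated TORSION, `(Sel⁺_∞)^γ`, `(Sel⁺_∞)_γ` finite, `g(0) ≠ 0`, and **`g(0) ∣ #Sel_{2^∞}(E/ℚ) · 2^{ord₂ ∏ c_ℓ}` in `ℤ₂`**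
(`ord₂ g(0) ≤ ord₂ #Sel + ord₂ ∏ c_ℓ`): Greenberg's Lemma 4.2 `g(0) · #S_Γ = u · #S^Γ` (tree, dual pair) × Lemma 4.3 for `Sel⁺` × `#ker g⁺ ∣ 2^{ord₂∏c}`
(`SignedEC.natCard_signedSelmerInvariants_mul_dvd_of_localInj`) × `#E(ℚ)[2^∞] = 1`. Seat `prover-bsd-wall-tp2-p3` (lead, LINE mode).
HONEST FRAMING: THEOREMS ONLY, route-independent; the displayed hypothesis INJ⁺@2 is the `±` local theory at `2` (not in print); nothing about
any curve is asserted; closes no item; BSD is not proved by any of this.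

References: [BDKim2013] Cor. 3.15 and its proof (pp. 199–200); [GreenbergLNM1716] §4 Lemmas 4.2–4.4 (pp. 102–104); [Kobayashi2003] Def. 1.1.
-/

set_option autoImplicit false
-- the Theorems namespace of this sub repeats the summit name by design (D-0017 nested layout)
set_option linter.dupNamespace false

noncomputable section

open scoped Classical NumberField

open NumberField IsDedekindDomain

namespace Summit.BirchSwinnertonDyer.BirchSwinnertonDyer.Theorems.SignedEC

open Literature.NumberTheory.EllipticCurves Literature.NumberTheory.GaloisRepresentations
  WeierstrassCurve ZpExtension Literature.NumberTheory.EllipticCurves.Kobayashi2003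
  Literature.NumberTheory.EllipticCurves.IwasawaDual Literature.NumberTheory.EllipticCurves.IwasawaAlgebra
  Literature.NumberTheory.EllipticCurves.Rank1Residual

variable (W : WeierstrassCurve ℚ) [W.IsElliptic] [W.IsGloballyMinimal]

/-- **The one-sided signed control value at `2` from INJ⁺@2 alone.** `W/ℚ` good supersingular at `2`, `κ` the cyclotomic `ℤ₂`-extension with
topological generator `γ`, INJ⁺@2 («`r₂⁺` injective»: every class of `A⁺_0` is classically Selmer at the place above `2`), `D` any Pontryagin-dual
datum of `Sel⁺(E/ℚ_∞)`, `char X⁺ = (g)`, `Sel_{2^∞}(E/ℚ)` finite. Then `X⁺` is `Λ`-torsion, `g(0) ≠ 0`, and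
**`g(0) ∣ #Sel_{2^∞}(E/ℚ) · 2^{ord₂ ∏_ℓ c_ℓ}` in `ℤ₂`** — the `≤` half of B. D. Kim's Cor. 3.15 at `2` (`|g(0)| ∼ |S^Γ|/|S_Γ|`, Lemma 4.2;
`|S^Γ| = |Sel|·|ker g|`, Lemma 4.3; `|ker g| ∣ ∏ c_ℓ^{(2)}` under «`r₂⁺` injective»), with no Poitou–Tate and no Thm. 1.1 input.
[cite: BDKim2013, Cor. 3.15 and its proof (pp. 199–200)] [cite: GreenbergLNM1716, §4 Lemmas 4.2–4.4 (pp. 102–104)] -/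
theorem constantCoeff_dvd_natCard_selmer_mul_pow_of_localInj (hss : GoodSS W 2) {κ : ZpExtension ℚ 2} (hκ : κ.IsCyclotomic)
    {γ : Field.absoluteGaloisGroup ℚ} (hγ : κ.IsTopGenerator γ)
    (hinj : ∀ v : HeightOneSpectrum (𝓞 ℚ), (2 : 𝓞 ℚ) ∈ v.asIdeal →
      ∀ y ∈ (signedSelmerInfty W κ 1).comap (W.layerToInfty κ 0),
        W.localResOver 2 (κ.layerSubgroup 0) (v.adicCompletion ℚ) y = 0)
    (D : SignedSelmerDualData W κ γ 1) {g : IwasawaAlgebra 2} (hg : D.charIdeal = Ideal.span {g})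
    (hfin : Finite (W.selmerGroupPInfty 2)) :
    (haveI := D.moduleFinite hγ; Module.IsTorsion (IwasawaAlgebra 2) D.X) ∧ PowerSeries.constantCoeff g ≠ 0 ∧
      PowerSeries.constantCoeff g ∣
        ((Nat.card (W.selmerGroupPInfty 2) * 2 ^ padicValNat 2 W.tamagawaProduct : ℕ) : ℤ_[2]) := by
  haveI := D.moduleFinite hγ
  -- INJ⁺ ⇒ `(Sel⁺_∞)^γ` finite and `#S^Γ · #E[2^∞]^Γ ∣ #Sel · 2^{ord₂ ∏ c}`
  obtain ⟨hfinΓ, hdvd⟩ := natCard_signedSelmerInvariants_mul_dvd_of_localInj W 2 1 hκ hγ hinj hfin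
  rw [natCard_fixedPoints_geomPrimaryTorsion_two_eq_one W hss, mul_one] at hdvd
  haveI := hfinΓ
  have htor : Module.IsTorsion (IwasawaAlgebra 2) D.X := D.isTorsion_of_finite_endInvariants hγ hfinΓ
  have hdp := D.isDualPair hγ
  have hg' : Module.charIdeal (IwasawaAlgebra 2) D.X = Ideal.span {g} := hg
  -- Greenberg's Lemma 4.2: `g(0) · #S_Γ = u · #S^Γ`, `g(0) ≠ 0`
  obtain ⟨u, hu⟩ := hdp.constantCoeff_charGenerator_mul_natCard_endCoinvariants htor g hg' hfinΓ
  have hg0 := (hdp.order_charGenerator_eq_zero_of_finite_endInvariants htor g hg' hfinΓ).2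
  refine ⟨htor, hg0, ?_⟩
  -- `g(0) ∣ u · #S^Γ ∣ u · (#Sel · 2^{ord₂∏c})`, and `u` is a unit
  have h1 : PowerSeries.constantCoeff g ∣ (u : ℤ_[2]) * (Nat.card ↥(endInvariants (conjSignedSelmerInfty W κ 1 γ - 1)) : ℤ_[2]) :=
    ⟨(Nat.card (EndCoinvariants (conjSignedSelmerInfty W κ 1 γ - 1)) : ℤ_[2]), hu.symm⟩
  have h2 : ((Nat.card ↥(endInvariants (conjSignedSelmerInfty W κ 1 γ - 1)) : ℕ) : ℤ_[2]) ∣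
      ((Nat.card (W.selmerGroupPInfty 2) * 2 ^ padicValNat 2 W.tamagawaProduct : ℕ) : ℤ_[2]) := by
    exact_mod_cast Nat.cast_dvd_cast hdvd
  have h3 := h1.trans (mul_dvd_mul_left (u : ℤ_[2]) h2)
  exact (Units.dvd_mul_left).mp h3

/-- **`ord₂` form**: under the same hypotheses, `(g(0)).valuation ≤ ord₂ #Sel_{2^∞}(E/ℚ) + ord₂ ∏ c_ℓ` — stated as the divisibility
`g(0) ∣ 2^{ord₂ #Sel + ord₂ ∏ c_ℓ}` in `ℤ₂` (`#Sel_{2^∞}(E/ℚ)` is a power of `2` times a unit: it divides `2^{ord₂ #Sel}` up to a unit).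
[cite: BDKim2013, Cor. 3.15 (pp. 199–200)] -/
theorem constantCoeff_dvd_two_pow_of_localInj (hss : GoodSS W 2) {κ : ZpExtension ℚ 2} (hκ : κ.IsCyclotomic)
    {γ : Field.absoluteGaloisGroup ℚ} (hγ : κ.IsTopGenerator γ)
    (hinj : ∀ v : HeightOneSpectrum (𝓞 ℚ), (2 : 𝓞 ℚ) ∈ v.asIdeal →
      ∀ y ∈ (signedSelmerInfty W κ 1).comap (W.layerToInfty κ 0),
        W.localResOver 2 (κ.layerSubgroup 0) (v.adicCompletion ℚ) y = 0)
    (D : SignedSelmerDualData W κ γ 1) {g : IwasawaAlgebra 2} (hg : D.charIdeal = Ideal.span {g})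
    (hfin : Finite (W.selmerGroupPInfty 2)) :
    PowerSeries.constantCoeff g ∣
      ((2 : ℤ_[2]) ^ (padicValNat 2 (Nat.card (W.selmerGroupPInfty 2)) + padicValNat 2 W.tamagawaProduct)) := by
  obtain ⟨-, -, hdvd⟩ := constantCoeff_dvd_natCard_selmer_mul_pow_of_localInj W hss hκ hγ hinj D hg hfin
  haveI := hfin
  have hN : Nat.card (W.selmerGroupPInfty 2) ≠ 0 := Nat.card_pos.ne'
  -- `#Sel = 2^k · m` with `m` odd, `k = ord₂ #Sel`, and odd naturals are units of `ℤ₂`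
  obtain ⟨k, m, hm, hkm⟩ := Nat.exists_eq_two_pow_mul_odd hN
  have hm0 : m ≠ 0 := hm.pos.ne'
  have hk : padicValNat 2 (Nat.card (W.selmerGroupPInfty 2)) = k := by
    rw [hkm, padicValNat.mul (pow_ne_zero k two_ne_zero) hm0, padicValNat.prime_pow,
      padicValNat.eq_zero_of_not_dvd hm.not_two_dvd_nat, add_zero]
  have hmunit : IsUnit ((m : ℕ) : ℤ_[2]) := by
    rw [PadicInt.isUnit_iff]
    have hle : ‖((m : ℤ) : ℤ_[2])‖ ≤ 1 := PadicInt.norm_le_one _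
    have hnlt : ¬ ‖((m : ℤ) : ℤ_[2])‖ < 1 := by
      rw [PadicInt.norm_int_lt_one_iff_dvd]
      exact_mod_cast hm.not_two_dvd_nat
    rw [show ((m : ℕ) : ℤ_[2]) = ((m : ℤ) : ℤ_[2]) by norm_cast]
    exact le_antisymm hle (not_lt.mp hnlt)
  rw [hk, pow_add]
  have hcast : ((Nat.card (W.selmerGroupPInfty 2) * 2 ^ padicValNat 2 W.tamagawaProduct : ℕ) : ℤ_[2]) =
      (2 : ℤ_[2]) ^ k * 2 ^ padicValNat 2 W.tamagawaProduct * ((m : ℕ) : ℤ_[2]) := by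
    rw [hkm]; push_cast; ring
  rw [hcast] at hdvd
  exact (hmunit.dvd_mul_right).mp hdvd

end Summit.BirchSwinnertonDyer.BirchSwinnertonDyer.Theorems.SignedEC

end
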